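import Summits.ResolutionOfSingularities.ResolutionOfSingularities.Theorems.FrobeniusLadderFRationalResolutionLocalModelTransfer
import Summits.ResolutionOfSingularities.ResolutionOfSingularities.Theorems.FrobeniusLadderFRationalResolutionIsolatedGlue
import Literature.AlgebraicGeometry.Resolution.AffineBlowupResolutionCriterion
import Literature.AlgebraicGeometry.Resolution.CanonicalResolutionProofs
import HarnessLib

/-!
# Crux `FrobeniusLadder.FRationalResolution` (stmt-ResolutionOfSingularities-15317), line `redirect`,
# stub `stub_diagonalizableQuotientResolution` — CONE MODELS: isolated singularities whose germs are
# vertex germs of one-blow-up cones are resolvable, in every dimension, over every field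

Assembly of `…IsolatedGlue.lean` (finite singular locus + `hloc` ⇒ resolution),
`…LocalModelTransfer.lean` (`hloc` from a `k`-isomorphic stalk of a one-singular-point model) and the
Literature one-blow-up criterion (`AffineBlowupResolutionCriterion.lean`: `Bl_I(Spec R) → Spec R` is
proper, an isomorphism over `Spec R ∖ V(I)` — `affineBlowup.isIso_morphismRestrict_iSup` — with dense
preimage of `D(a)` for a non-zero-divisor `a ∈ I`):

* `affineBlowup_model_datum` — for a domain `R`, a finitely generated ideal `I ≠ 0` whose affine
  blow-up is a regular scheme: `Bl_I(Spec R) → Spec R` is proper with regular source, an isomorphism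
  over `⨆_{a ∈ I} D(a)` with dense preimage;
* `regularLocus_opens_eq_iSup_basicOpen` — if `Reg(Spec R)` is exactly the complement of `V(I)`, the
  regular locus (as an open) is `⨆_{a ∈ I} D(a)`;
* `hloc_of_cone_model` — **`hloc` at a point `s` of an integral `X/k` whose local ring is
  `k`-isomorphic to the local ring of such a CONE MODEL `(R, I)` at its vertex `q`** (`V(I) ⊆ {q}`,
  `Reg = Spec R ∖ V(I)`);
* `hasResolution_of_cone_model_stalks` — **an integral `X` locally of finite type over any field
  with finitely many singular points, each of whose germs is a vertex germ of a cone model, has a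
  resolution of singularities.** The landed specimen families (Veronese cones `V(n,r) = 𝔸ⁿ/μ_r` in
  all dimensions — the simplest ISOLATED diagonalizable quotient singularities —, Segre cones) are
  cone models in this sense (`veroneseCone_isRegular_affineBlowup`, `veroneseCone_mem_regularLocus_iff`,
  `veroneseCone_compl_regularLocus_eq_singleton`; Segre likewise); instantiation is left to the
  consumer to keep this file free of their notations.

Honest label: Zariski-local models (stalk isomorphisms); for the stub's ÉTALE charts the transfer
goes through descent of the centre (`…PrimaryDescent.lean`). No definitions, no named facts, no sorry.
[folklore; cite: GortzWedhorn2020, Prop. 13.91 (4); Kollar2007, §2.2]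
-/

noncomputable section

-- single-problem summit: the doubled namespace component is forced
set_option linter.dupNamespace false

open CategoryTheory AlgebraicGeometry TopologicalSpace
open Literature.AlgebraicGeometry.Resolution

namespace Summit.ResolutionOfSingularities.ResolutionOfSingularities.Theorems.FRationalResolution.ConeModels

/-! ## The one-blow-up model datum -/

/-- **The affine blow-up of a domain along a finitely generated non-zero ideal with regular
blow-up is a local-resolution datum**: `Bl_I(Spec R) → Spec R` is proper, its source is regular, it
is an isomorphism over `⨆_{a ∈ I} D(a) = Spec R ∖ V(I)`, and the preimage of that open is dense.
[cite: GortzWedhorn2020, Prop. 13.91 (4)] -/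
theorem affineBlowup_model_datum {R : Type} [CommRing R] [IsDomain R] (I : Ideal R) (hfg : I.FG)
    (hI : I ≠ ⊥) (hreg : Scheme.IsRegular (affineBlowup I)) :
    ∃ (Y : Scheme.{0}) (ρ : Y ⟶ Spec (.of R)), IsProper ρ ∧ Scheme.IsRegular Y ∧
      IsIso (ρ ∣_ ⨆ a : I, (PrimeSpectrum.basicOpen (a : R) : (Spec (.of R)).Opens)) ∧
      Dense ((ρ ⁻¹ᵁ ⨆ a : I, (PrimeSpectrum.basicOpen (a : R) : (Spec (.of R)).Opens) : Y.Opens) :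
        Set Y) := by
  obtain ⟨a, haI, ha0⟩ := Submodule.exists_mem_ne_zero_of_ne_bot hI
  have ha : a ∈ nonZeroDivisors R := mem_nonZeroDivisors_of_ne_zero ha0
  refine ⟨affineBlowup I, affineBlowup.π I, affineBlowup.isProper_of_fg I hfg, hreg,
    affineBlowup.isIso_morphismRestrict_iSup, ?_⟩
  have hle : (PrimeSpectrum.basicOpen a : (Spec (.of R)).Opens) ≤
      ⨆ b : I, (PrimeSpectrum.basicOpen (b : R) : (Spec (.of R)).Opens) :=
    le_iSup (fun b : I => (PrimeSpectrum.basicOpen (b : R) : (Spec (.of R)).Opens)) ⟨a, haI⟩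
  exact (affineBlowup.dense_preimage_basicOpen_of_mem_nonZeroDivisors (I := I) ha).mono
    fun y hy => hle hy

/-- **If the regular locus of `Spec R` is the complement of `V(I)`, then as an open it is
`⨆_{a ∈ I} D(a)`.** [folklore] -/
theorem regularLocus_opens_eq_iSup_basicOpen {R : Type} [CommRing R] (I : Ideal R)
    (hopen : IsOpen (Scheme.regularLocus (Spec (.of R))))
    (hRegI : ∀ P : Spec (.of R), P ∈ Scheme.regularLocus (Spec (.of R)) ↔ ¬ I ≤ P.asIdeal) :
    (⟨Scheme.regularLocus (Spec (.of R)), hopen⟩ : (Spec (.of R)).Opens) =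
      ⨆ a : I, (PrimeSpectrum.basicOpen (a : R) : (Spec (.of R)).Opens) := by
  ext P
  constructor
  · intro hP
    obtain ⟨a, haI, haP⟩ := SetLike.not_le_iff_exists.mp ((hRegI P).mp hP)
    exact Opens.mem_iSup.mpr ⟨⟨a, haI⟩, (PrimeSpectrum.mem_basicOpen _ _).mpr haP⟩
  · intro hP
    obtain ⟨⟨a, haI⟩, haP⟩ := Opens.mem_iSup.mp hP
    exact (hRegI P).mpr (SetLike.not_le_iff_exists.mpr ⟨a, haI, (PrimeSpectrum.mem_basicOpen _ _).mp haP⟩)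

/-! ## `hloc` from a cone model -/

/-- **Local resolution at a point whose germ is the vertex germ of a cone model.** Let `X` be an
integral `k`-scheme locally of finite type and `s ∈ X`. Let `R` be a domain of finite type over `k`
(the CONE MODEL) with a finitely generated ideal `I ≠ 0` such that the affine blow-up `Bl_I(Spec R)`
is regular, the regular locus of `Spec R` is exactly the complement of `V(I)`, and `V(I) ⊆ {q}` for a
point `q` (the vertex); and let `e : 𝒪_{Spec R, q} ≅ 𝒪_{X,s}` be a `k`-isomorphism of germs. Then
`s` has an open `V ∋ s` containing no other singular point of `X` and a proper `ρ : Y → V`, `Y`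
regular, an isomorphism over `V ∩ Reg X` with dense preimage. [cite: Kollar2007, §2.2] -/
theorem hloc_of_cone_model (k : Type) [Field k] (X : Scheme.{0}) [IsIntegral X]
    (f : X ⟶ Spec (.of k)) [LocallyOfFiniteType f] (s : X)
    (R : Type) [CommRing R] [IsDomain R] [Algebra k R]
    [LocallyOfFiniteType (Spec.map (CommRingCat.ofHom (algebraMap k R)))]
    (I : Ideal R) (hfg : I.FG) (hI : I ≠ ⊥) (hreg : Scheme.IsRegular (affineBlowup I))
    (hRegI : ∀ P : Spec (.of R), P ∈ Scheme.regularLocus (Spec (.of R)) ↔ ¬ I ≤ P.asIdeal)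
    (q : Spec (.of R)) (hq : ∀ t : Spec (.of R), I ≤ t.asIdeal → t = q)
    (e : (Spec (.of R)).presheaf.stalk q ≅ X.presheaf.stalk s)
    (he : Spec.map e.hom ≫ (Spec (.of R)).fromSpecStalk q ≫
      Spec.map (CommRingCat.ofHom (algebraMap k R)) = X.fromSpecStalk s ≫ f) :
    ∃ (V : X.Opens), s ∈ V ∧ (∀ t : X, t ∉ Scheme.regularLocus X → t ∈ V → t = s) ∧
      ∃ (Y : Scheme.{0}) (ρ : Y ⟶ V), IsProper ρ ∧ Scheme.IsRegular Y ∧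
        IsIso (ρ ∣_ (V.ι ⁻¹ᵁ ⟨Scheme.regularLocus X, isOpen_regularLocus_of_locallyOfFiniteType_field f⟩)) ∧
        Dense ((ρ ⁻¹ᵁ (V.ι ⁻¹ᵁ ⟨Scheme.regularLocus X,
          isOpen_regularLocus_of_locallyOfFiniteType_field f⟩) : Y.Opens) : Set Y) := by
  set g : Spec (.of R) ⟶ Spec (.of k) := Spec.map (CommRingCat.ofHom (algebraMap k R)) with hg
  have hopen : IsOpen (Scheme.regularLocus (Spec (.of R))) :=
    isOpen_regularLocus_of_locallyOfFiniteType_field g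
  -- the only possibly singular point of the model is the vertex
  have hq' : ∀ t : Spec (.of R), t ∉ Scheme.regularLocus (Spec (.of R)) → t = q := by
    intro t ht
    rw [hRegI, not_not] at ht
    exact hq t ht
  -- the model's one-blow-up resolution, an isomorphism over `Reg = ⨆ D(a)`
  have hW := regularLocus_opens_eq_iSup_basicOpen I hopen hRegI
  have hres : ∃ (Y : Scheme.{0}) (ρ : Y ⟶ Spec (.of R)), IsProper ρ ∧ Scheme.IsRegular Y ∧
      IsIso (ρ ∣_ ⟨Scheme.regularLocus (Spec (.of R)), isOpen_regularLocus_of_locallyOfFiniteType_field g⟩) ∧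
      Dense ((ρ ⁻¹ᵁ ⟨Scheme.regularLocus (Spec (.of R)),
        isOpen_regularLocus_of_locallyOfFiniteType_field g⟩ : Y.Opens) : Set Y) := by
    rw [hW]
    exact affineBlowup_model_datum I hfg hI hreg
  exact LocalModelTransfer.hloc_of_stalk_iso_model k X f s (Spec (.of R)) g q hq' e he hres

/-! ## Resolution of varieties with cone-model singular germs -/

/-- **Varieties with finitely many singular points whose germs are vertex germs of cone models are
resolvable** (every dimension, every field): for `X` integral and locally of finite type over `k`
with `X ∖ Reg X` finite, if every singular point `s` admits a cone model `(R, I, q)` as in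
`hloc_of_cone_model` with `𝒪_{Spec R, q} ≅ 𝒪_{X,s}` over `k`, then `X` has a resolution of
singularities (`hloc_of_cone_model` + `IsolatedGlue.hasResolution_of_finite_singularLocus_of_local`).
[cite: Kollar2007, §2.2] -/
theorem hasResolution_of_cone_model_stalks (k : Type) [Field k] (X : Scheme.{0}) [IsIntegral X]
    (f : X ⟶ Spec (.of k)) [LocallyOfFiniteType f] (hfin : (Scheme.regularLocus X)ᶜ.Finite)
    (hmodel : ∀ s : X, s ∉ Scheme.regularLocus X →
      ∃ (R : Type) (_ : CommRing R) (_ : IsDomain R) (_ : Algebra k R)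
        (_ : LocallyOfFiniteType (Spec.map (CommRingCat.ofHom (algebraMap k R))))
        (I : Ideal R) (_ : I.FG) (_ : I ≠ ⊥) (_ : Scheme.IsRegular (affineBlowup I))
        (_ : ∀ P : Spec (.of R), P ∈ Scheme.regularLocus (Spec (.of R)) ↔ ¬ I ≤ P.asIdeal)
        (q : Spec (.of R)) (_ : ∀ t : Spec (.of R), I ≤ t.asIdeal → t = q)
        (e : (Spec (.of R)).presheaf.stalk q ≅ X.presheaf.stalk s),
        Spec.map e.hom ≫ (Spec (.of R)).fromSpecStalk q ≫
          Spec.map (CommRingCat.ofHom (algebraMap k R)) = X.fromSpecStalk s ≫ f) :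
    Scheme.HasResolution X := by
  refine IsolatedGlue.hasResolution_of_finite_singularLocus_of_local k X f hfin fun s hs => ?_
  obtain ⟨R, _, _, _, _, I, hfg, hI, hreg, hRegI, q, hq, e, he⟩ := hmodel s hs
  exact hloc_of_cone_model k X f s R I hfg hI hreg hRegI q hq e he

end Summit.ResolutionOfSingularities.ResolutionOfSingularities.Theorems.FRationalResolution.ConeModels

end
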